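import Summits.RiemannHypothesis.RiemannHypothesis.Theses.WeilGroundState
import Summits.RiemannHypothesis.RiemannHypothesis.Theorems.WeilGroundStateGroundStatesConvergeToXiLineExactWeak
import Summits.RiemannHypothesis.RiemannHypothesis.Theorems.WeilGroundStateGroundStatesConvergeToXiTransfer
import Summits.RiemannHypothesis.RiemannHypothesis.Theorems.WeilGroundStateGroundStatesConvergeToXiRHofTight
import Literature.NumberTheory.LFunctions.WeilGroundState
import HarnessLib

/-!
# LINE ⟷ CRUX exactness for `GroundStatesConvergeToXi` (line `Sketch`)
(crux item stmt-RiemannHypothesis-1527, route route-RiemannHypothesis-WeilGroundState; `--supports`)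

The line `Sketch` reduces the crux to C⁺ (`stub_tightWeakLimit`: renormalised ground states
`c_k u_k` TIGHT in every weighted `L¹(e^{b|t|})`, `b < 1/2`, and WEAKLY convergent to Riemann's
kernel `Φ = 2Ψ(2·)`).  With the converse transfer
(`tendsto_integral_mul_of_tendsto_criticalLine`, file `…LineExactWeak.lean`) the relation between
the line's open stub and the crux becomes exact:

* `tightWeakLimit_iff_tight_cruxWitness` — **C⁺ ⟺ ∃ a witness `(a_k, u_k, c_k)` of the crux
  which is tight for every `b < 1/2`.**  So the ONLY demand the line adds to the crux is
  tightness below the polar exponent `1/2`.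
* `tight_of_nonneg` / `tightWeakLimit_of_nonneg_cruxWitness` — tightness for every `b < 1/2` is
  AUTOMATIC for witnesses whose renormalised ground states `c_k u_k` are a.e. real and
  non-negative (the Perron–Frobenius shape the route expects): `∫ c_k u_k e^{b|t|} ≤
  c_k û_k(1/2 + b) + c_k û_k(1/2 − b)`, bounded by convergence at the real points of the strip.
  For such witnesses C⁺ and the crux are the SAME statement.
* `riemannHypothesis_of_tight_cruxWitness` / `riemannHypothesis_of_groundStatesConvergeToXi_tight`
  — **a witness of the crux that is tight at ONE exponent `b₀ > 1/2` proves RH** (no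
  `GroundStateSimpleEven`, no Connes–van Suijlekom, no Hurwitz): tightness at `b₀ > 0` gives
  `L¹`-boundedness, convergence on the critical line gives the weak limit `Φ`, and
  `riemannHypothesis_of_tightWeakLimit_strong` (C⁺⁺ ⇒ RH) applies.  Contrapositive
  (`not_tight_cruxWitness_of_not_riemannHypothesis`): under ¬RH every witness of the crux has
  `sup_k ∫ |c_k u_k| e^{b₀|t|} = ∞` for every `b₀ > 1/2` — the formal shadow of edge
  concentration.

So the gap between the line's stub and RH is exactly the tightness exponent crossing the polar
weight `e^{|t|/2}`: `b < 1/2` is what the open strip sees, `b > 1/2` is what Weil's functional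
(polar term + prime sum) needs.
-/

noncomputable section

set_option linter.dupNamespace false

open scoped Topology Real
open Filter Set MeasureTheory Complex

namespace Summit.RiemannHypothesis.RiemannHypothesis.Theorems.GroundStatesConvergeToXi

open Literature.NumberTheory.LFunctions

/-! ## Tightness bookkeeping -/

/-- Tightness at an exponent `b ≥ 0` gives `L¹`-boundedness (`e^{b|t|} ≥ 1`). [folklore] -/
theorem integral_norm_le_of_tight {a : ℕ → ℝ} {u : ℕ → ℝ → ℂ} {c : ℕ → ℂ}
    (hu : ∀ k, IsWeilGroundState (a k) (u k)) {b M : ℝ} (hb : 0 ≤ b)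
    (hM : ∀ k, ∫ t, ‖c k * u k t‖ * Real.exp (b * |t|) ≤ M) (k : ℕ) :
    ∫ t, ‖c k * u k t‖ ≤ M := by
  refine le_trans (integral_mono_of_nonneg (ae_of_all _ fun t => norm_nonneg _)
    (stub_pointwise_of_weak_integrable_weight (hu k) (c k) b) (ae_of_all _ fun t => ?_)) (hM k)
  have h1 : 1 ≤ Real.exp (b * |t|) := Real.one_le_exp (by positivity)
  simpa using mul_le_mul_of_nonneg_left h1 (norm_nonneg (c k * u k t))

/-- Tightness is monotone in the exponent: `(T_b)` implies `(T_{b'})` for `b' ≤ b`. [folklore] -/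
theorem tight_mono {a : ℕ → ℝ} {u : ℕ → ℝ → ℂ} {c : ℕ → ℂ}
    (hu : ∀ k, IsWeilGroundState (a k) (u k)) {b b' M : ℝ} (hb : b' ≤ b)
    (hM : ∀ k, ∫ t, ‖c k * u k t‖ * Real.exp (b * |t|) ≤ M) (k : ℕ) :
    ∫ t, ‖c k * u k t‖ * Real.exp (b' * |t|) ≤ M := by
  refine le_trans (integral_mono_of_nonneg (ae_of_all _ fun t => by positivity)
    (stub_pointwise_of_weak_integrable_weight (hu k) (c k) b) (ae_of_all _ fun t => ?_)) (hM k)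
  exact mul_le_mul_of_nonneg_left (Real.exp_le_exp.2
    (mul_le_mul_of_nonneg_right hb (abs_nonneg t))) (norm_nonneg _)

/-- Points of the critical line lie in the open strip. [folklore] -/
theorem criticalLine_mem_strip (τ : ℝ) :
    (1 / 2 + (τ : ℂ) * I) ∈ {s : ℂ | 0 < s.re ∧ s.re < 1} := by
  constructor <;> norm_num

/-- Real points `σ ∈ (0,1)` lie in the open strip. [folklore] -/
theorem ofReal_mem_strip {σ : ℝ} (hσ : σ ∈ Ioo (0 : ℝ) 1) :
    ((σ : ℂ)) ∈ {s : ℂ | 0 < s.re ∧ s.re < 1} := by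
  simpa using hσ

/-! ## C⁺ ⟺ tight witness of the crux -/

/-- **LINE ⟷ CRUX exactness.**  The line's load-bearing stub C⁺ (`stub_tightWeakLimit`:
tightness in every `L¹(e^{b|t|})`, `b < 1/2`, + weak convergence to `Φ`) is EQUIVALENT to the
existence of a witness `(a_k, u_k, c_k)` of the crux's shape (ground states along `a_k → ∞`,
`c_k ≠ 0`, `c_k · weilMellin u_k → ξ` locally uniformly on the open strip) that is tight for every
`b < 1/2`.  (`→`: the landed transfer `tendstoLocallyUniformlyOn_of_tight_of_weak`; `←`:
tightness at `b = 0` and convergence at the points `1/2 + iτ` of the strip feed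
`tendsto_integral_mul_of_tendsto_criticalLine`.) -/
theorem tightWeakLimit_iff_tight_cruxWitness :
    (∃ a : ℕ → ℝ, ∃ u : ℕ → ℝ → ℂ, ∃ c : ℕ → ℂ, Tendsto a atTop atTop ∧ (∀ k, c k ≠ 0) ∧
      (∀ k, IsWeilGroundState (a k) (u k)) ∧
      (∀ b : ℝ, b < 1 / 2 → ∃ M : ℝ, ∀ k, ∫ t, ‖c k * u k t‖ * Real.exp (b * |t|) ≤ M) ∧
      (∀ g : ℝ → ℂ, IsWeilTest g →
        Tendsto (fun k => ∫ t, c k * u k t * g t) atTop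
          (𝓝 (∫ t, 2 * LagariasMontague.Psic (2 * t) * g t)))) ↔
    (∃ a : ℕ → ℝ, ∃ u : ℕ → ℝ → ℂ, ∃ c : ℕ → ℂ, Tendsto a atTop atTop ∧ (∀ k, c k ≠ 0) ∧
      (∀ k, IsWeilGroundState (a k) (u k)) ∧
      (∀ b : ℝ, b < 1 / 2 → ∃ M : ℝ, ∀ k, ∫ t, ‖c k * u k t‖ * Real.exp (b * |t|) ≤ M) ∧
      TendstoLocallyUniformlyOn (fun k s => c k * weilMellin (u k) s) riemannXi atTop
        {s : ℂ | 0 < s.re ∧ s.re < 1}) := by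
  constructor
  · rintro ⟨a, u, c, ha, hc, hu, htight, hweak⟩
    exact ⟨a, u, c, ha, hc, hu, htight, tendstoLocallyUniformlyOn_of_tight_of_weak hu htight hweak⟩
  · rintro ⟨a, u, c, ha, hc, hu, htight, hlim⟩
    refine ⟨a, u, c, ha, hc, hu, htight, fun g hg => ?_⟩
    obtain ⟨M, hM⟩ := htight 0 (by norm_num)
    exact tendsto_integral_mul_of_tendsto_criticalLine (fun k => (hu k).integrable)
      ⟨M, integral_norm_le_of_tight hu le_rfl hM⟩
      (fun τ => hlim.tendsto_at (criticalLine_mem_strip τ)) hg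

/-- **C⁺ ⟺ the crux WITH tightness** — the same equivalence with the crux's window clause
spelled out verbatim (`0 < a k ∧ c k ≠ 0 ∧ MemLp (u k) 2 ∧ ∃ g, …` is
`IsWeilGroundState (a k) (u k)` unfolded): C⁺ holds iff `GroundStatesConvergeToXi` has a witness
whose renormalised ground states are bounded in every `L¹(e^{b|t|})`, `b < 1/2`. -/
theorem tightWeakLimit_iff_groundStatesConvergeToXi_tight :
    (∃ a : ℕ → ℝ, ∃ u : ℕ → ℝ → ℂ, ∃ c : ℕ → ℂ, Tendsto a atTop atTop ∧ (∀ k, c k ≠ 0) ∧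
      (∀ k, IsWeilGroundState (a k) (u k)) ∧
      (∀ b : ℝ, b < 1 / 2 → ∃ M : ℝ, ∀ k, ∫ t, ‖c k * u k t‖ * Real.exp (b * |t|) ≤ M) ∧
      (∀ g : ℝ → ℂ, IsWeilTest g →
        Tendsto (fun k => ∫ t, c k * u k t * g t) atTop
          (𝓝 (∫ t, 2 * LagariasMontague.Psic (2 * t) * g t)))) ↔
    (∃ a : ℕ → ℝ, ∃ u : ℕ → ℝ → ℂ, ∃ c : ℕ → ℂ, Tendsto a atTop atTop ∧
      (∀ k, 0 < a k ∧ c k ≠ 0 ∧ MemLp (u k) 2 ∧ ∃ g : ℕ → ℝ → ℂ,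
        (∀ n, IsWeilTest (g n) ∧ tsupport (g n) ⊆ Icc (-(a k)) (a k) ∧
          ∫ t, ‖g n t‖ ^ 2 = (1 : ℝ)) ∧
        Tendsto (fun n => (weilQuadratic (g n)).re) atTop (𝓝 (weilGroundEnergy (a k))) ∧
        Tendsto (fun n => ∫ t, ‖g n t - u k t‖ ^ 2) atTop (𝓝 0)) ∧
      (∀ b : ℝ, b < 1 / 2 → ∃ M : ℝ, ∀ k, ∫ t, ‖c k * u k t‖ * Real.exp (b * |t|) ≤ M) ∧
      TendstoLocallyUniformlyOn (fun k s => c k * weilMellin (u k) s) riemannXi atTop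
        {s : ℂ | 0 < s.re ∧ s.re < 1}) := by
  rw [tightWeakLimit_iff_tight_cruxWitness]
  constructor
  · rintro ⟨a, u, c, ha, hc, hu, htight, hlim⟩
    exact ⟨a, u, c, ha, fun k => ⟨(hu k).pos, hc k, (hu k).1, (hu k).2⟩, htight, hlim⟩
  · rintro ⟨a, u, c, ha, hk, htight, hlim⟩
    exact ⟨a, u, c, ha, fun k => (hk k).2.1, fun k => ⟨(hk k).2.2.1, (hk k).2.2.2⟩, htight, hlim⟩

/-! ## Tightness is automatic for non-negative renormalised ground states -/

/-- **Laplace bound for non-negative functions.**  If `v` is a.e. real and non-negative, a.e.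
zero off a compact window (so all exponential moments exist), then for every real `b`
`∫ ‖v‖ e^{b|t|} ≤ ‖v̂(1/2 + b)‖ + ‖v̂(1/2 − b)‖` (`e^{b|t|} ≤ e^{bt} + e^{-bt}` and
`∫ v e^{±bt} = v̂(1/2 ± b)`). [folklore] -/
theorem integral_norm_mul_exp_le_of_nonneg {a : ℝ} {u : ℝ → ℂ} (hu : IsWeilGroundState a u)
    (c : ℂ) (hnn : ∀ᵐ t : ℝ, 0 ≤ (c * u t).re ∧ (c * u t).im = 0) (b : ℝ) :
    ∫ t, ‖c * u t‖ * Real.exp (b * |t|) ≤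
      ‖c * weilMellin u (1 / 2 + b)‖ + ‖c * weilMellin u (1 / 2 - b)‖ := by
  -- the two one-sided Laplace integrals
  have hI : ∀ b' : ℝ, Integrable fun t : ℝ => c * u t * cexp ((b' : ℂ) * t) := fun b' =>
    ((hu.integrable_mul_cexp b').const_mul c).congr (ae_of_all _ fun t => by ring)
  have hL : ∀ b' : ℝ, ∫ t : ℝ, c * u t * cexp ((b' : ℂ) * t) = c * weilMellin u (1 / 2 + b') := by
    intro b'
    rw [← weilMellin_const_mul, weilMellin]
    refine integral_congr_ae (ae_of_all _ fun t => ?_)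
    have e : (1 / 2 + (b' : ℂ) - 1 / 2) * (t : ℂ) = (b' : ℂ) * t := by ring
    dsimp only
    rw [e, mul_assoc]
  have hIre : ∀ b' : ℝ, Integrable fun t : ℝ => (c * u t * cexp ((b' : ℂ) * t)).re := fun b' => by
    simpa only [RCLike.re_to_complex] using (hI b').re
  have hLre : ∀ b' : ℝ, ∫ t : ℝ, (c * u t * cexp ((b' : ℂ) * t)).re =
      (∫ t : ℝ, c * u t * cexp ((b' : ℂ) * t)).re := fun b' => by
    simpa only [RCLike.re_to_complex] using integral_re (hI b')
  -- pointwise: ‖v‖ e^{b|t|} ≤ Re (v e^{bt}) + Re (v e^{-bt})  a.e.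
  have re_mul : ∀ r β t : ℝ, ((r : ℂ) * cexp ((β : ℂ) * t)).re = r * Real.exp (β * t) := by
    intro r β t
    rw [show (β : ℂ) * (t : ℂ) = ((β * t : ℝ) : ℂ) by push_cast; rfl, ← Complex.ofReal_exp,
      ← Complex.ofReal_mul, Complex.ofReal_re]
  have hpt : ∀ᵐ t : ℝ, ‖c * u t‖ * Real.exp (b * |t|) ≤
      (c * u t * cexp ((b : ℂ) * t)).re + (c * u t * cexp (((-b : ℝ) : ℂ) * t)).re := by
    filter_upwards [hnn] with t ht
    have hv : c * u t = ((c * u t).re : ℂ) := by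
      apply Complex.ext <;> simp [ht.2]
    have hnorm : ‖c * u t‖ = (c * u t).re := by
      rw [hv, Complex.norm_real, Real.norm_of_nonneg ht.1]
      simp
    have e1 : (c * u t * cexp ((b : ℂ) * t)).re = (c * u t).re * Real.exp (b * t) := by
      conv_lhs => rw [hv]
      exact re_mul _ _ _
    have e2 : (c * u t * cexp (((-b : ℝ) : ℂ) * t)).re = (c * u t).re * Real.exp (-b * t) := by
      conv_lhs => rw [hv]
      exact re_mul _ _ _
    rw [e1, e2, hnorm, ← mul_add]
    refine mul_le_mul_of_nonneg_left ?_ ht.1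
    rcases le_or_gt 0 t with h0 | h0
    · rw [abs_of_nonneg h0]
      linarith [Real.exp_pos (-b * t)]
    · rw [abs_of_neg h0]
      have : b * -t = -b * t := by ring
      rw [this]
      linarith [Real.exp_pos (b * t)]
  calc ∫ t, ‖c * u t‖ * Real.exp (b * |t|)
      ≤ ∫ t, ((c * u t * cexp ((b : ℂ) * t)).re + (c * u t * cexp (((-b : ℝ) : ℂ) * t)).re) :=
        integral_mono_ae (stub_pointwise_of_weak_integrable_weight hu c b)
          ((hIre b).add (hIre (-b))) hpt
    _ = (∫ t, c * u t * cexp ((b : ℂ) * t)).re + (∫ t, c * u t * cexp (((-b : ℝ) : ℂ) * t)).re := by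
        rw [integral_add (hIre b) (hIre (-b)), hLre b, hLre (-b)]
    _ = (c * weilMellin u (1 / 2 + b)).re + (c * weilMellin u (1 / 2 - b)).re := by
        rw [hL b, hL (-b)]
        push_cast
        ring_nf
    _ ≤ ‖c * weilMellin u (1 / 2 + b)‖ + ‖c * weilMellin u (1 / 2 - b)‖ :=
        add_le_add (Complex.re_le_norm _) (Complex.re_le_norm _)

/-- **Tightness is automatic for non-negative witnesses.**  For ground states `u_k` and scalars
`c_k` with `c_k u_k` a.e. real and non-negative, boundedness of `c_k û_k(σ)` at the real points
`σ ∈ (0,1)` of the strip (implied by the crux's convergence) gives tightness in every weighted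
`L¹(e^{b|t|})`, `b < 1/2`. -/
theorem tight_of_nonneg {a : ℕ → ℝ} {u : ℕ → ℝ → ℂ} {c : ℕ → ℂ}
    (hu : ∀ k, IsWeilGroundState (a k) (u k))
    (hnn : ∀ k, ∀ᵐ t : ℝ, 0 ≤ (c k * u k t).re ∧ (c k * u k t).im = 0)
    (hbd : ∀ σ : ℝ, σ ∈ Ioo (0 : ℝ) 1 → ∃ B : ℝ, ∀ k, ‖c k * weilMellin (u k) σ‖ ≤ B) :
    ∀ b : ℝ, b < 1 / 2 → ∃ M : ℝ, ∀ k, ∫ t, ‖c k * u k t‖ * Real.exp (b * |t|) ≤ M := by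
  intro b hb
  set b' : ℝ := max b 0 with hb'
  have hb'0 : 0 ≤ b' := le_max_right _ _
  have hb'1 : b' < 1 / 2 := max_lt hb (by norm_num)
  obtain ⟨B₁, hB₁⟩ := hbd (1 / 2 + b') ⟨by linarith, by linarith⟩
  obtain ⟨B₂, hB₂⟩ := hbd (1 / 2 - b') ⟨by linarith, by linarith⟩
  refine ⟨B₁ + B₂, fun k => (tight_mono hu (le_max_left b 0) (M := B₁ + B₂) (fun k => ?_) k)⟩
  calc ∫ t, ‖c k * u k t‖ * Real.exp (b' * |t|)
      ≤ ‖c k * weilMellin (u k) (1 / 2 + b')‖ + ‖c k * weilMellin (u k) (1 / 2 - b')‖ :=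
        integral_norm_mul_exp_le_of_nonneg (hu k) (c k) (hnn k) b'
    _ ≤ B₁ + B₂ := by
        have e₁ : ((1 / 2 + b' : ℝ) : ℂ) = 1 / 2 + (b' : ℂ) := by push_cast; rfl
        have e₂ : ((1 / 2 - b' : ℝ) : ℂ) = 1 / 2 - (b' : ℂ) := by push_cast; rfl
        refine add_le_add ?_ ?_
        · rw [← e₁]; exact hB₁ k
        · rw [← e₂]; exact hB₂ k

/-- **For non-negative witnesses the line's stub IS the crux.**  If the crux has a witness
`(a_k, u_k, c_k)` whose renormalised ground states `c_k u_k` are a.e. real and non-negative (the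
Perron–Frobenius shape), then C⁺ (`stub_tightWeakLimit`) holds: tightness for `b < 1/2` from
`tight_of_nonneg` (convergent sequences are bounded), weak convergence from
`tendsto_integral_mul_of_tendsto_criticalLine`. -/
theorem tightWeakLimit_of_nonneg_cruxWitness
    (h : ∃ a : ℕ → ℝ, ∃ u : ℕ → ℝ → ℂ, ∃ c : ℕ → ℂ, Tendsto a atTop atTop ∧ (∀ k, c k ≠ 0) ∧
      (∀ k, IsWeilGroundState (a k) (u k)) ∧
      (∀ k, ∀ᵐ t : ℝ, 0 ≤ (c k * u k t).re ∧ (c k * u k t).im = 0) ∧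
      TendstoLocallyUniformlyOn (fun k s => c k * weilMellin (u k) s) riemannXi atTop
        {s : ℂ | 0 < s.re ∧ s.re < 1}) :
    ∃ a : ℕ → ℝ, ∃ u : ℕ → ℝ → ℂ, ∃ c : ℕ → ℂ, Tendsto a atTop atTop ∧ (∀ k, c k ≠ 0) ∧
      (∀ k, IsWeilGroundState (a k) (u k)) ∧
      (∀ b : ℝ, b < 1 / 2 → ∃ M : ℝ, ∀ k, ∫ t, ‖c k * u k t‖ * Real.exp (b * |t|) ≤ M) ∧
      (∀ g : ℝ → ℂ, IsWeilTest g →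
        Tendsto (fun k => ∫ t, c k * u k t * g t) atTop
          (𝓝 (∫ t, 2 * LagariasMontague.Psic (2 * t) * g t))) := by
  obtain ⟨a, u, c, ha, hc, hu, hnn, hlim⟩ := h
  have hbd : ∀ σ : ℝ, σ ∈ Ioo (0 : ℝ) 1 → ∃ B : ℝ, ∀ k, ‖c k * weilMellin (u k) σ‖ ≤ B := by
    intro σ hσ
    have ht : Tendsto (fun k => ‖c k * weilMellin (u k) σ‖) atTop (𝓝 ‖riemannXi σ‖) :=
      (hlim.tendsto_at (ofReal_mem_strip hσ)).norm
    obtain ⟨B, hB⟩ := ht.bddAbove_range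
    exact ⟨B, fun k => hB ⟨k, rfl⟩⟩
  have htight := tight_of_nonneg hu hnn hbd
  exact tightWeakLimit_iff_tight_cruxWitness.2 ⟨a, u, c, ha, hc, hu, htight, hlim⟩

/-! ## A tight witness of the crux proves RH -/

/-- **RH from a witness of the crux tight at one exponent `b₀ > 1/2`** (critical-line form).
Ground states `u_k` along `a_k → ∞` and scalars `c_k` with `c_k u_k` bounded in ONE weighted
`L¹(e^{b₀|t|})`, `b₀ > 1/2`, and `c_k û_k → ξ` pointwise on the critical line, imply the Riemann
hypothesis: tightness at `b₀ ≥ 0` gives `∫ |c_k u_k| ≤ M`, the critical line gives the weak limit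
`Φ` (`tendsto_integral_mul_of_tendsto_criticalLine`), and C⁺⁺ ⇒ RH
(`riemannHypothesis_of_tightWeakLimit_strong`). -/
theorem riemannHypothesis_of_tight_of_tendsto_criticalLine
    (h : ∃ a : ℕ → ℝ, ∃ u : ℕ → ℝ → ℂ, ∃ c : ℕ → ℂ, Tendsto a atTop atTop ∧
      (∀ k, IsWeilGroundState (a k) (u k)) ∧
      (∃ b₀ : ℝ, 1 / 2 < b₀ ∧ ∃ M : ℝ, ∀ k, ∫ t, ‖c k * u k t‖ * Real.exp (b₀ * |t|) ≤ M) ∧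
      (∀ τ : ℝ, Tendsto (fun k => c k * weilMellin (u k) (1 / 2 + τ * I)) atTop
        (𝓝 (riemannXi (1 / 2 + τ * I))))) :
    RiemannHypothesis := by
  obtain ⟨a, u, c, ha, hu, ⟨b₀, hb₀, M, hM⟩, hline⟩ := h
  exact riemannHypothesis_of_tightWeakLimit_strong ⟨a, u, c, ha, hu, ⟨b₀, hb₀, M, hM⟩,
    fun g hg => tendsto_integral_mul_of_tendsto_criticalLine (fun k => (hu k).integrable)
      ⟨M, integral_norm_le_of_tight hu (by linarith) hM⟩ hline hg⟩

/-- **RH from a tight witness of the crux** (shape of the line's statements).  Ground states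
`u_k` along `a_k → ∞`, scalars `c_k`, `c_k · weilMellin u_k → ξ` locally uniformly on the open
strip, and tightness at ONE exponent `b₀ > 1/2` imply RH. -/
theorem riemannHypothesis_of_tight_cruxWitness
    (h : ∃ a : ℕ → ℝ, ∃ u : ℕ → ℝ → ℂ, ∃ c : ℕ → ℂ, Tendsto a atTop atTop ∧
      (∀ k, IsWeilGroundState (a k) (u k)) ∧
      (∃ b₀ : ℝ, 1 / 2 < b₀ ∧ ∃ M : ℝ, ∀ k, ∫ t, ‖c k * u k t‖ * Real.exp (b₀ * |t|) ≤ M) ∧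
      TendstoLocallyUniformlyOn (fun k s => c k * weilMellin (u k) s) riemannXi atTop
        {s : ℂ | 0 < s.re ∧ s.re < 1}) :
    RiemannHypothesis := by
  obtain ⟨a, u, c, ha, hu, htight, hlim⟩ := h
  exact riemannHypothesis_of_tight_of_tendsto_criticalLine ⟨a, u, c, ha, hu, htight,
    fun τ => hlim.tendsto_at (criticalLine_mem_strip τ)⟩

/-- **RH from `GroundStatesConvergeToXi` with tightness** — the crux's clauses verbatim plus
boundedness of the renormalised ground states in ONE `L¹(e^{b₀|t|})`, `b₀ > 1/2`, imply RH
(without `GroundStateSimpleEven`, Connes–van Suijlekom or Hurwitz). -/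
theorem riemannHypothesis_of_groundStatesConvergeToXi_tight
    (h : ∃ a : ℕ → ℝ, ∃ u : ℕ → ℝ → ℂ, ∃ c : ℕ → ℂ, Tendsto a atTop atTop ∧
      (∀ k, 0 < a k ∧ c k ≠ 0 ∧ MemLp (u k) 2 ∧ ∃ g : ℕ → ℝ → ℂ,
        (∀ n, IsWeilTest (g n) ∧ tsupport (g n) ⊆ Icc (-(a k)) (a k) ∧
          ∫ t, ‖g n t‖ ^ 2 = (1 : ℝ)) ∧
        Tendsto (fun n => (weilQuadratic (g n)).re) atTop (𝓝 (weilGroundEnergy (a k))) ∧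
        Tendsto (fun n => ∫ t, ‖g n t - u k t‖ ^ 2) atTop (𝓝 0)) ∧
      (∃ b₀ : ℝ, 1 / 2 < b₀ ∧ ∃ M : ℝ, ∀ k, ∫ t, ‖c k * u k t‖ * Real.exp (b₀ * |t|) ≤ M) ∧
      TendstoLocallyUniformlyOn (fun k s => c k * weilMellin (u k) s) riemannXi atTop
        {s : ℂ | 0 < s.re ∧ s.re < 1}) :
    RiemannHypothesis := by
  obtain ⟨a, u, c, ha, hk, htight, hlim⟩ := h
  exact riemannHypothesis_of_tight_cruxWitness
    ⟨a, u, c, ha, fun k => ⟨(hk k).2.2.1, (hk k).2.2.2⟩, htight, hlim⟩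

/-- **Edge escape under ¬RH.**  If RH fails, then for EVERY witness `(a_k, u_k, c_k)` of the
crux's shape and every `b₀ > 1/2` the weighted masses `∫ |c_k u_k| e^{b₀|t|}` are unbounded in
`k`: whatever renormalisation makes the transforms converge to `ξ` on the strip lets mass escape
towards the window edges faster than `e^{-b₀|t|}` can tame (contrapositive of
`riemannHypothesis_of_tight_cruxWitness`). -/
theorem not_tight_cruxWitness_of_not_riemannHypothesis (hRH : ¬ RiemannHypothesis)
    {a : ℕ → ℝ} {u : ℕ → ℝ → ℂ} {c : ℕ → ℂ} (ha : Tendsto a atTop atTop)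
    (hu : ∀ k, IsWeilGroundState (a k) (u k))
    (hlim : TendstoLocallyUniformlyOn (fun k s => c k * weilMellin (u k) s) riemannXi atTop
      {s : ℂ | 0 < s.re ∧ s.re < 1})
    {b₀ : ℝ} (hb₀ : 1 / 2 < b₀) (M : ℝ) :
    ∃ k, M < ∫ t, ‖c k * u k t‖ * Real.exp (b₀ * |t|) := by
  by_contra hcon
  push Not at hcon
  exact hRH (riemannHypothesis_of_tight_cruxWitness ⟨a, u, c, ha, hu, ⟨b₀, hb₀, M, hcon⟩, hlim⟩)

end Summit.RiemannHypothesis.RiemannHypothesis.Theorems.GroundStatesConvergeToXi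

end
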